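import Summits.Ventures.HSemireg.WedgeHankelRecurrenceCensusDet
import Summits.Ventures.HSemireg.WedgeHankelRecurrenceCensusPrefix

/-!
# Venture HSemireg — SQUARE HANKEL MATRICES WITH A PRESCRIBED BEGINNING: fix the first `k ≤ t` entries `a` of the sequence `v_0, …, v_{2t}`; then **exactly `s^{2t−k}` of the
# `s^{2t+1−k}` square Hankel matrices `(v_{i+j})_{i,j ≤ t}` over a field with `s` elements with that beginning are SINGULAR and `(s − 1)·s^{2t−k}` are nonsingular — probability `1/s`,
# whatever the prescribed entries** (Dwivedi–Grinberg 2022, Corollary 2, which generalises Anzis–Chen–Gao–Kim–Li–Patrias; here = N48's census with prefix read through N47's determinant)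

HONEST FRAMING. Part of the Lean index of the computation cell `pub-hsemireg` (seat p10 gen 28, Sunday typer «UNIFORM-IN-n»).
LINEAR ALGEBRA OF HANKEL (catalecticant) MATRICES over a field ONLY: no variety, no cohomology theory, no sheaf, no Ext group and no semiregularity map is constructed here; nothing here
says that HC / HC_CM / HC_AV holds; no Literature fact is declared or used.  Custodian versions as in `WedgeHankelSiegelIdeal` (1/3).  READING (not used): Dwivedi–Grinberg, Linear
Algebra Appl. 2022, arXiv:2109.05415, Corollary 2 (`#{x ∈ F^{2n+1} : x_{[0,k)} = a, det H_{n,n}(x) = 0} = q^{2n−k}` for `k ≤ n`) and §5 there (Jacobi–Trudi ∕ Anzis et al.).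

WHAT IS KEYED.  N47 (`WedgeHankelRecurrenceCensusDet`, № 330): `hankelSq`, `rank_hankelSq`, `rank_hankelSq_eq_iff_det_ne_zero`; N48 (`WedgeHankelRecurrenceCensusPrefix` v2, № 331):
`prefixOf`, `ncard_setOf_prefixOf`, `ncard_setOf_prefixOf_rank_half_le`; N44 (№ 326) `seqOf`.  Mathlib: `Set.ncard_sdiff`, `Matrix.rank_le_height`.
THIS FILE (namespace `Summit.Ventures.HSemireg.Wedge.HankelOuter` continued; CHAINED ×2 on N47 + N48; 0 definitions):
* §564 **`ncard_setOf_prefixOf_det_hankelSq_eq_zero`** (`k ≤ t ⇒ #{v : prefixOf v = a, det (hankelSq t v) = 0} = s^{2t−k}`), **`ncard_setOf_prefixOf_det_hankelSq_ne_zero`**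
  (`= (s − 1)·s^{2t−k}`), `ncard_setOf_prefixOf_rank_hankelSq_le` (`k ≤ r ≤ t ⇒ #{prefixOf v = a, rank ≤ r} = s^{2r−k}`).
Nothing Ext-side.  New names only.
-/

open Module Polynomial
open scoped Matrix Polynomial

namespace Summit.Ventures.HSemireg.Wedge.HankelOuter

open Summit.Ventures.HSemireg.Wedge Summit.Ventures.HSemireg.Wedge.Hankel

variable (K : Type*) [Field K]

/-! ## §564. Determinants with a prescribed beginning -/

/-- **for `k ≤ r ≤ t` and every prefix `a` of length `k`, exactly `s^{2r−k}` square Hankel matrices `(v_{i+j})_{i,j ≤ t}` with `(v_0, …, v_{k−1}) = a` have rank `≤ r`.** -/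
theorem ncard_setOf_prefixOf_rank_hankelSq_le [Finite K] {k r t : ℕ} (hkr : k ≤ r) (hrt : r ≤ t) (a : Fin k → K) :
    {v : Fin (2 * t + 1) → K | prefixOf K k v = a ∧ (hankelSq K t (seqOf K v)).rank ≤ r}.ncard = Nat.card K ^ (2 * r - k) := by
  rw [← ncard_setOf_prefixOf_rank_half_le K (N := 2 * t) hkr (by omega) a]
  congr 1
  ext v
  rw [Set.mem_setOf_eq, Set.mem_setOf_eq, rank_hankelSq]

/-- **SINGULAR SQUARE HANKEL MATRICES WITH A PRESCRIBED BEGINNING (Dwivedi–Grinberg's Corollary 2, re-derived): for `k ≤ t` and every `a ∈ K^k`, exactly `s^{2t−k}` of the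
`s^{2t+1−k}` matrices `(v_{i+j})_{i,j ≤ t}` with `(v_0, …, v_{k−1}) = a` have determinant `0`.** -/
theorem ncard_setOf_prefixOf_det_hankelSq_eq_zero [Finite K] {k t : ℕ} (hkt : k ≤ t) (a : Fin k → K) :
    {v : Fin (2 * t + 1) → K | prefixOf K k v = a ∧ (hankelSq K t (seqOf K v)).det = 0}.ncard = Nat.card K ^ (2 * t - k) := by
  rw [← ncard_setOf_prefixOf_rank_hankelSq_le K hkt le_rfl a]
  congr 1
  ext v
  have hle : (hankelSq K t (seqOf K v)).rank ≤ t + 1 := Matrix.rank_le_height _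
  have hiff := rank_hankelSq_eq_iff_det_ne_zero K t (seqOf K v)
  rw [Set.mem_setOf_eq, Set.mem_setOf_eq]
  refine and_congr_right fun _ => ⟨fun h => ?_, fun h => ?_⟩
  · by_contra hlt
    exact (hiff.mp (by omega)) h
  · by_contra hne
    have := hiff.mpr hne
    omega

/-- **… and exactly `(s − 1)·s^{2t−k}` are NONSINGULAR** — the fraction `1 − 1/s` of the matrices with the prescribed beginning, whatever the beginning. -/
theorem ncard_setOf_prefixOf_det_hankelSq_ne_zero [Finite K] {k t : ℕ} (hkt : k ≤ t) (a : Fin k → K) :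
    {v : Fin (2 * t + 1) → K | prefixOf K k v = a ∧ (hankelSq K t (seqOf K v)).det ≠ 0}.ncard = (Nat.card K - 1) * Nat.card K ^ (2 * t - k) := by
  have hsub : {v : Fin (2 * t + 1) → K | prefixOf K k v = a ∧ (hankelSq K t (seqOf K v)).det = 0} ⊆ {v : Fin (2 * t + 1) → K | prefixOf K k v = a} := fun v hv => hv.1
  have key : {v : Fin (2 * t + 1) → K | prefixOf K k v = a ∧ (hankelSq K t (seqOf K v)).det ≠ 0}
      = {v : Fin (2 * t + 1) → K | prefixOf K k v = a} \ {v : Fin (2 * t + 1) → K | prefixOf K k v = a ∧ (hankelSq K t (seqOf K v)).det = 0} := by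
    ext v
    simp only [Set.mem_setOf_eq, Set.mem_sdiff, not_and]
    exact ⟨fun h => ⟨h.1, fun _ => h.2⟩, fun h => ⟨h.1, h.2 h.1⟩⟩
  rw [key, Set.ncard_sdiff hsub (Set.toFinite _), ncard_setOf_prefixOf K (by omega) a, ncard_setOf_prefixOf_det_hankelSq_eq_zero K hkt a,
    show 2 * t + 1 - k = (2 * t - k) + 1 by omega, pow_succ]
  obtain ⟨u, hu⟩ := Nat.exists_eq_add_of_le' (Finite.one_lt_card (α := K)).le
  rw [hu, Nat.add_sub_cancel]
  have e : (u + 1) ^ (2 * t - k) * (u + 1) = u * (u + 1) ^ (2 * t - k) + (u + 1) ^ (2 * t - k) := by ring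
  omega

end Summit.Ventures.HSemireg.Wedge.HankelOuter
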